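import Summits.CriticalPhenomena.PercolationContinuityZ3.Theorems.PercNearOneGluingNoHeavyLowerTailThreePointLBSwitchingClusters
import Literature.Probability.Percolation.DecisionTreeWeighted
import Mathlib.Tactic.Linarith
import HarnessLib

/-!
# `NoHeavyLowerTail` (stmt-CriticalPhenomena-4575) — THEOREM R3 of the separating-cluster refinement:
# `u_c · b₀ ≥ s_a · s_b` on EVERY finite weighted graph, by ONE cluster exchange

Support file (prover prim-gen-kcluster gen 35; `--supports stmt-CriticalPhenomena-4575`).  No named facts, no sorries.

Setting (KCLUSTER-gen32 §4, KCLUSTER-gen33 §9, THEOREM-R3-SWITCHING.md of run/shared/lean/prim/prim-gen-kcluster/): Bernoulli bond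
percolation with arbitrary edge probabilities `p` on the SUPPORT `D ⊆ Sym2 V` (configurations `X ⊆ D`, masses `PrW D p`), terminals
`a b c`, `cl X v` the open cluster of `v`.  The three-point cell `a|b|c` ("pairwise apart") is REFINED by graph separation in the
support: `Sep D W u v` says that the vertex set `W` meets every `u–v` path of the support graph (`v ∉ cl (D ∖ touch W) u`).  Cells:
* `cellUc` — `u_c`: `b ∈ cl X a`, `c ∉ cl X a` (`ab|c`);
* `cellSa` — `s_a`: pairwise apart and `cl X a` separates `b` from `c` in the support; `cellSb`, `cellSc` likewise;
* `cellB0` — `b₀`: pairwise apart and none of the three clusters separates the other two terminals.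
On a support joining `a, b, c` the three separation events are pairwise disjoint (`not_sep_sep`), so
`a|b|c = S_a ⊔ S_b ⊔ S_c ⊔ B_0`.

**Theorem R3** (`r3_PrW`): if `b, c ∈ cl D a` (the terminals lie in one component of the support) then
`PrW(cellSa) · PrW(cellSb) ≤ PrW(cellUc) · PrW(cellB0)`, i.e. `s_a s_b ≤ u_c b₀`.
(Census row R3 of KCLUSTER-gen32; without the support hypothesis the statement is false: `c` isolated gives `b₀ = 0 < s_a s_b`.)

**Proof** (THEOREM-R3-SWITCHING.md): two independent copies `(X, Y)` and the Gladkov–Zimin one-cluster exchange along `L = cl X b`,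
`swapPair (fun X => touch (cl X b)) (X, Y) = (X on touch L | Y elsewhere, Y on touch L | X elsewhere)`, which preserves `μ ⊗ μ`
(`DecisionTree.Pr2W_preimage_swapPair`, `Gladkov.selfDetermined_touch_cl`).  POINTWISE (`pointwise`): for `X ∈ S_a`, `Y ∈ S_b ∪ B_0`
the first output is in `B_0` (its `b`-cluster is the sealed `L` (F1), its `a`- and `c`-clusters are sub-clusters of `Y`'s (F2), and `L`
does not separate `a|c` because `cl X a` separates `b|c`) and the second is in `U_c ∪ S_a` (it keeps `cl X a` (F3), and its `c`-cluster stays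
inside the support component `R_c` of `c` off `cl X a`, which contains neither `a` nor `b`).  Hence
`s_a (s_b + b₀) = μ⊗μ(S_a × (S_b ∪ B_0)) ≤ μ⊗μ(B_0 × (U_c ∪ S_a)) = b₀ (u_c + s_a)`.
[cite: GladkovZimin2024, Lemma 4.2 and Example 4.4 (one-cluster exchange)] for the exchange; the refined cells and the row are this
programme's (KCLUSTER-gen32/33).
-/

noncomputable section

namespace Summit.CriticalPhenomena.PercolationContinuityZ3.Theorems

namespace RefinedRowR3

open Finset Literature.Probability.Percolation Literature.Probability.Percolation.DecisionTree
open Literature.Probability.Percolation.Gladkov ThreePointLB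
open scoped Classical

variable {V : Type*} [Fintype V] [DecidableEq V]

/-! ### Separation in the support graph and the refined cells -/

/-- `Sep D W u v`: the vertex set `W` meets every `u–v` path of the support graph `D`
(`v` is not reachable from `u` by support pairs avoiding `W`; vertex separation up to the endpoints). [folklore] -/
def Sep (D : Finset (Sym2 V)) (W : Finset V) (u v : V) : Prop := v ∉ cl (D \ touch W) u

section Cells

variable (D : Finset (Sym2 V)) (a b c : V)

/-- `a|b|c`: the three terminals are pairwise apart. [this work] -/
def apart : Set (Finset (Sym2 V)) := {X | b ∉ cl X a ∧ c ∉ cl X a ∧ c ∉ cl X b}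

/-- `S_a`: pairwise apart and the cluster of `a` separates `b` from `c` in the support. [this work] -/
def cellSa : Set (Finset (Sym2 V)) := {X | X ∈ apart a b c ∧ Sep D (cl X a) b c}

/-- `S_b`: pairwise apart and the cluster of `b` separates `a` from `c` in the support. [this work] -/
def cellSb : Set (Finset (Sym2 V)) := {X | X ∈ apart a b c ∧ Sep D (cl X b) a c}

/-- `S_c`: pairwise apart and the cluster of `c` separates `a` from `b` in the support. [this work] -/
def cellSc : Set (Finset (Sym2 V)) := {X | X ∈ apart a b c ∧ Sep D (cl X c) a b}

/-- `B_0`: pairwise apart and no cluster of a terminal separates the other two. [this work] -/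
def cellB0 : Set (Finset (Sym2 V)) :=
  {X | X ∈ apart a b c ∧ ¬ Sep D (cl X a) b c ∧ ¬ Sep D (cl X b) a c ∧ ¬ Sep D (cl X c) a b}

/-- `U_c` (`ab|c`): `b` in the cluster of `a`, `c` not. [this work] -/
def cellUc : Set (Finset (Sym2 V)) := {X | b ∈ cl X a ∧ c ∉ cl X a}

variable {D a b c}

omit [DecidableEq V] in
/-- Membership in `apart`. [this work] -/
@[simp] theorem mem_apart {X : Finset (Sym2 V)} : X ∈ apart a b c ↔ b ∉ cl X a ∧ c ∉ cl X a ∧ c ∉ cl X b := Iff.rfl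
/-- Membership in `cellSa`. [this work] -/
@[simp] theorem mem_cellSa {X : Finset (Sym2 V)} : X ∈ cellSa D a b c ↔ X ∈ apart a b c ∧ Sep D (cl X a) b c := Iff.rfl
/-- Membership in `cellSb`. [this work] -/
@[simp] theorem mem_cellSb {X : Finset (Sym2 V)} : X ∈ cellSb D a b c ↔ X ∈ apart a b c ∧ Sep D (cl X b) a c := Iff.rfl
/-- Membership in `cellSc`. [this work] -/
@[simp] theorem mem_cellSc {X : Finset (Sym2 V)} : X ∈ cellSc D a b c ↔ X ∈ apart a b c ∧ Sep D (cl X c) a b := Iff.rfl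
/-- Membership in `cellB0`. [this work] -/
@[simp] theorem mem_cellB0 {X : Finset (Sym2 V)} : X ∈ cellB0 D a b c ↔
    X ∈ apart a b c ∧ ¬ Sep D (cl X a) b c ∧ ¬ Sep D (cl X b) a c ∧ ¬ Sep D (cl X c) a b := Iff.rfl
omit [DecidableEq V] in
/-- Membership in `cellUc`. [this work] -/
@[simp] theorem mem_cellUc {X : Finset (Sym2 V)} : X ∈ cellUc a b c ↔ b ∈ cl X a ∧ c ∉ cl X a := Iff.rfl

end Cells

/-! ### Small calculus of support separation -/

/-- `Sep` is symmetric in the two separated vertices. [folklore] -/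
theorem sep_comm {D : Finset (Sym2 V)} {W : Finset V} {u v : V} : Sep D W u v ↔ Sep D W v u := by
  unfold Sep; rw [mem_cl_comm]

/-- A superset of a separator separates. [folklore] -/
theorem Sep.mono {D : Finset (Sym2 V)} {W W' : Finset V} {u v : V} (h : Sep D W u v) (hW : W ⊆ W') :
    Sep D W' u v := fun hv =>
  h (cl_mono (Finset.sdiff_subset_sdiff subset_rfl (touch_mono hW)) u hv)

/-- A cluster avoiding `W` of a configuration inside the support lies in one support component off `W`:
if `x ∉ W`, `X ⊆ D` and `cl X x ∩ W = ∅` then `cl X x ⊆ cl (D ∖ touch W) x`. [folklore] -/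
theorem cl_subset_cl_sdiff_touch {D X : Finset (Sym2 V)} {W : Finset V} {x : V} (hXD : X ⊆ D)
    (hW : ∀ v ∈ cl X x, v ∉ W) : cl X x ⊆ cl (D \ touch W) x := by
  intro v hv
  obtain ⟨w⟩ := mem_cl.1 hv
  refine mem_cl.2 (reachable_of_walk (C := cl X x) (fun y y' hy hyy' => mem_cl_of_adj hy hyy') ?_ w
    (mem_cl_self X x))
  intro y y' hy hyy'
  have hy' : y' ∈ cl X x := mem_cl_of_adj hy hyy'
  rw [adj_iff] at hyy' ⊢
  refine ⟨Finset.mem_sdiff.2 ⟨hXD hyy'.1, ?_⟩, hyy'.2⟩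
  rw [mk_mem_touch, not_or]
  exact ⟨hW y hy, hW y' hy'⟩

/-- **Two clusters cannot both separate** (on a support joining the terminals): if `y ∉ cl X x`, `z ∈ cl D x`,
then `cl X x` separating `y|z` and `cl X y` separating `x|z` cannot hold together.  (Walk from `x` to `z` in the support:
the set `cl (D ∖ touch (cl X y)) x ∪ cl (D ∖ touch (cl X x)) y` is closed under support adjacency, so contains `z`.) [this work] -/
theorem not_sep_sep {D X : Finset (Sym2 V)} {x y z : V} (hXD : X ⊆ D) (hxy : y ∉ cl X x) (hz : z ∈ cl D x)
    (h1 : Sep D (cl X x) y z) (h2 : Sep D (cl X y) x z) : False := by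
  set K := cl X x with hK
  set L := cl X y with hL
  have hyx : x ∉ L := fun h => hxy (mem_cl_comm.1 h)
  -- K ⊆ A := cl (D \ touch L) x and L ⊆ B := cl (D \ touch K) y
  have hKA : K ⊆ cl (D \ touch L) x := cl_subset_cl_sdiff_touch hXD fun v hv => not_mem_cl_of_mem_cl hv hxy
  have hLB : L ⊆ cl (D \ touch K) y := cl_subset_cl_sdiff_touch hXD fun v hv => not_mem_cl_of_mem_cl hv hyx
  -- the union is closed under support adjacency
  set C : Finset V := cl (D \ touch L) x ∪ cl (D \ touch K) y with hC
  have hclosed : ∀ u v, u ∈ C → (openGraph (↑D : Set (Sym2 V))).Adj u v → v ∈ C := by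
    intro u v hu huv
    rw [adj_iff] at huv
    rcases Finset.mem_union.1 hu with hu | hu
    · by_cases hvL : v ∈ L
      · exact Finset.mem_union_right _ (hLB hvL)
      · have huL : u ∉ L := not_mem_of_mem_cl_sdiff_touch hyx hu
        refine Finset.mem_union_left _ (mem_cl_of_adj hu (adj_iff.2 ⟨Finset.mem_sdiff.2 ⟨huv.1, ?_⟩, huv.2⟩))
        rw [mk_mem_touch, not_or]; exact ⟨huL, hvL⟩
    · by_cases hvK : v ∈ K
      · exact Finset.mem_union_left _ (hKA hvK)
      · have huK : u ∉ K := not_mem_of_mem_cl_sdiff_touch hxy hu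
        refine Finset.mem_union_right _ (mem_cl_of_adj hu (adj_iff.2 ⟨Finset.mem_sdiff.2 ⟨huv.1, ?_⟩, huv.2⟩))
        rw [mk_mem_touch, not_or]; exact ⟨huK, hvK⟩
  obtain ⟨w⟩ := mem_cl.1 hz
  have hzC : z ∈ C := mem_of_walk hclosed w (Finset.mem_union_left _ (mem_cl_self _ x))
  rcases Finset.mem_union.1 hzC with hzA | hzB
  · exact h2 hzA
  · exact h1 hzB

/-! ### The pointwise lemma -/

section Pointwise

variable {D : Finset (Sym2 V)} {a b c : V}

/-- For `X ∈ S_a` (`X ⊆ D`): the support component `R_c = cl (D ∖ touch (cl X a)) c` of `c` off `K = cl X a` contains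
neither `a` nor `b` nor any vertex of `L = cl X b`, and it is closed under adjacency in the second output
`Q = (Y on touch L | X elsewhere)`; hence `cl Q c ⊆ R_c`. [this work] -/
theorem cl_splice_subset_Rc {X Y : Finset (Sym2 V)} (hXD : X ⊆ D) (hYD : Y ⊆ D) (hX : X ∈ cellSa D a b c) :
    cl (splice (touch (cl X b)) Y X) c ⊆ cl (D \ touch (cl X a)) c := by
  obtain ⟨⟨hab, hac, hbc⟩, hsep⟩ := hX
  set K := cl X a with hK
  set L := cl X b with hL
  set Rc := cl (D \ touch K) c with hRc
  have hba : a ∉ L := fun h => hab (mem_cl_comm.1 h)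
  -- L lies in the support component of b off K, which misses R_c
  have hLB : L ⊆ cl (D \ touch K) b := cl_subset_cl_sdiff_touch hXD fun v hv => not_mem_cl_of_mem_cl hv hba
  have hLRc : ∀ u ∈ Rc, u ∉ L := by
    intro u hu huL
    exact hsep (mem_cl_trans (hLB huL) (mem_cl_comm.1 hu))
  have hKRc : ∀ u ∈ Rc, u ∉ K := fun u hu => not_mem_of_mem_cl_sdiff_touch hac hu
  have hclosed : ∀ u v, u ∈ Rc → (openGraph (↑(splice (touch L) Y X) : Set (Sym2 V))).Adj u v → v ∈ Rc := by
    intro u v hu huv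
    rw [adj_iff] at huv
    have huvD : s(u, v) ∈ D := by
      rcases (mem_splice.1 huv.1) with h | h
      · exact hYD h.2
      · exact hXD h.2
    by_cases hvK : v ∈ K
    · -- the pair avoids L, so it carries X's state: an X-open pair into K puts u in K
      exfalso
      have hvL : v ∉ L := not_mem_cl_of_mem_cl hvK hab
      have he : s(u, v) ∉ touch L := by rw [mk_mem_touch, not_or]; exact ⟨hLRc u hu, hvL⟩
      have heX : s(u, v) ∈ X := (mem_splice_of_not_mem he).1 huv.1
      have : u ∈ K := mem_cl_of_adj hvK (adj_iff.2 ⟨by rw [Sym2.eq_swap]; exact heX, huv.2.symm⟩)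
      exact hKRc u hu this
    · refine mem_cl_of_adj hu (adj_iff.2 ⟨Finset.mem_sdiff.2 ⟨huvD, ?_⟩, huv.2⟩)
      rw [mk_mem_touch, not_or]; exact ⟨hKRc u hu, hvK⟩
  intro v hv
  obtain ⟨w⟩ := mem_cl.1 hv
  exact mem_of_walk hclosed w (mem_cl_self _ c)

/-- **Pointwise lemma** (THEOREM-R3-SWITCHING.md (1)–(2)): for `X ∈ S_a`, `Y ∈ S_b ∪ B_0` (both inside a support joining
`a, b, c`), the exchange along `touch (cl X b)` sends `(X, Y)` to `B_0 × (U_c ∪ S_a)`. [this work] -/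
theorem pointwise {X Y : Finset (Sym2 V)} (hXD : X ⊆ D) (hYD : Y ⊆ D) (hDb : b ∈ cl D a) (hDc : c ∈ cl D a)
    (hX : X ∈ cellSa D a b c) (hY : Y ∈ cellSb D a b c ∪ cellB0 D a b c) :
    splice (touch (cl X b)) X Y ∈ cellB0 D a b c ∧
      splice (touch (cl X b)) Y X ∈ cellUc a b c ∪ cellSa D a b c := by
  have hX' := hX
  obtain ⟨⟨hab, hac, hbc⟩, hsep⟩ := hX
  set K := cl X a with hK
  set L := cl X b with hL
  set P := splice (touch L) X Y with hP
  set Q := splice (touch L) Y X with hQ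
  have hba : a ∉ L := fun h => hab (mem_cl_comm.1 h)
  -- facts about Y: apart, its a-cluster does not separate b|c, its c-cluster does not separate a|b
  have hYap : Y ∈ apart a b c := by
    rcases hY with hY | hY
    · exact hY.1
    · exact hY.1
  obtain ⟨hYab, hYac, hYbc⟩ := hYap
  have hYnsa : ¬ Sep D (cl Y a) b c := by
    rcases hY with hY | hY
    · exact fun h => not_sep_sep hYD hYab hDc h hY.2
    · exact hY.2.1
  have hYnsc : ¬ Sep D (cl Y c) a b := by
    rcases hY with hY | hY
    · -- S_b ∩ S_c = ∅: clusters of b and c cannot both separate (support joins b to a)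
      intro h
      have hDba : a ∈ cl D b := mem_cl_comm.1 hDb
      exact not_sep_sep (x := b) (y := c) (z := a) hYD hYbc hDba (sep_comm.1 hY.2) (sep_comm.1 h)
    · exact hY.2.2.2
  -- (1) P ∈ B_0
  have hPb : cl P b = L := cl_splice_touch X Y b
  have hPa : ∀ u, u ∈ cl P a ↔ u ∈ cl (Y \ touch L) a := fun u => mem_cl_splice_touch_iff_of_not_mem hba u
  have hPc : ∀ u, u ∈ cl P c ↔ u ∈ cl (Y \ touch L) c := fun u => mem_cl_splice_touch_iff_of_not_mem hbc u
  have hPaY : cl P a ⊆ cl Y a := fun u hu => cl_mono Finset.sdiff_subset a ((hPa u).1 hu)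
  have hPcY : cl P c ⊆ cl Y c := fun u hu => cl_mono Finset.sdiff_subset c ((hPc u).1 hu)
  have hP_ab : b ∉ cl P a := fun h => not_mem_of_mem_cl_sdiff_touch hba ((hPa b).1 h) (mem_cl_self X b)
  have hP_ac : c ∉ cl P a := fun h => hYac (hPaY h)
  have hP_bc : c ∉ cl P b := by rw [hPb]; exact hbc
  have hP1 : P ∈ cellB0 D a b c := by
    refine ⟨⟨hP_ab, hP_ac, hP_bc⟩, ?_, ?_, ?_⟩
    · exact fun h => hYnsa (h.mono hPaY)
    · rw [hPb]
      exact fun h => not_sep_sep hXD hab hDc hsep h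
    · exact fun h => hYnsc (h.mono hPcY)
  -- (2) Q ∈ U_c ∪ S_a
  have hKQ : K ⊆ cl Q a := cl_subset_cl_splice_touch_of_not_mem hba
  have hQc : cl Q c ⊆ cl (D \ touch K) c := cl_splice_subset_Rc hXD hYD hX'
  have hQ_ac : c ∉ cl Q a := fun h =>
    not_mem_of_mem_cl_sdiff_touch hac (hQc (mem_cl_comm.1 h)) (mem_cl_self X a)
  have hQ_bc : c ∉ cl Q b := fun h => hsep (mem_cl_comm.1 (hQc (mem_cl_comm.1 h)))
  have hP2 : Q ∈ cellUc a b c ∪ cellSa D a b c := by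
    by_cases hQ_ab : b ∈ cl Q a
    · exact Or.inl ⟨hQ_ab, hQ_ac⟩
    · exact Or.inr ⟨⟨hQ_ab, hQ_ac, hQ_bc⟩, hsep.mono hKQ⟩
  exact ⟨hP1, hP2⟩

end Pointwise

/-! ### THEOREM R3 -/

section Measure

variable (D : Finset (Sym2 V)) {p : Sym2 V → ℝ} (hp0 : ∀ e, 0 ≤ p e) (hp1 : ∀ e, p e ≤ 1) (a b c : V)
include hp0 hp1

/-- **THEOREM R3** (`s_a · s_b ≤ u_c · b₀` on every finite weighted graph whose support joins the terminals):
`PrW(S_a) · PrW(S_b) ≤ PrW(U_c) · PrW(B_0)`.  One Gladkov–Zimin cluster exchange along `cl X b`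
(`Pr2W_preimage_swapPair`) and the pointwise lemma. [this work] -/
theorem r3_PrW (hDb : b ∈ cl D a) (hDc : c ∈ cl D a) :
    PrW D p (cellSa D a b c) * PrW D p (cellSb D a b c) ≤
      PrW D p (cellUc a b c) * PrW D p (cellB0 D a b c) := by
  set Fm : Finset (Sym2 V) → Finset (Sym2 V) := fun X => touch (cl X b) with hFm
  have hF : SelfDetermined Fm := selfDetermined_touch_cl b
  set S : Set (Finset (Sym2 V) × Finset (Sym2 V)) := cellSa D a b c ×ˢ (cellSb D a b c ∪ cellB0 D a b c) with hS
  set T : Set (Finset (Sym2 V) × Finset (Sym2 V)) := cellB0 D a b c ×ˢ (cellUc a b c ∪ cellSa D a b c) with hT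
  -- the exchange maps S into T (on pairs inside the support)
  have hST : Pr2W D p S ≤ Pr2W D p (swapPair Fm ⁻¹' T) := by
    refine Pr2W_mono D hp0 hp1 fun x hx1 hx2 hx => ?_
    obtain ⟨hX, hY⟩ := Set.mem_prod.1 hx
    have key := pointwise hx1 hx2 hDb hDc hX hY
    show swapPair Fm x ∈ T
    exact Set.mem_prod.2 ⟨key.1, key.2⟩
  rw [Pr2W_preimage_swapPair D p hF T] at hST
  -- factorise both sides
  have hdisj1 : Disjoint (cellSb D a b c) (cellB0 D a b c) :=
    Set.disjoint_left.2 fun X h1 h2 => h2.2.2.1 h1.2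
  have hdisj2 : Disjoint (cellUc a b c) (cellSa D a b c) :=
    Set.disjoint_left.2 fun X h1 h2 => h2.1.1 h1.1
  rw [hS, Pr2W_prod, PrW_union D p hdisj1] at hST
  rw [hT, Pr2W_prod, PrW_union D p hdisj2] at hST
  have hsa := PrW_nonneg D hp0 hp1 (cellSa D a b c)
  have hb0 := PrW_nonneg D hp0 hp1 (cellB0 D a b c)
  nlinarith [hST, hsa, hb0]

end Measure

end RefinedRowR3

end Summit.CriticalPhenomena.PercolationContinuityZ3.Theorems

end
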